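import Mathlib
import Summits.Ventures.PercRepro2.CrossAPrimeCoinSplit

/-!
# The up-set tilts at the marks are theorems
(blind cell PercRepro2, p5 g38; `proofs/subclaims/S4-HARDSTEP.md` §2.4 (s) addendum 48)

`UPTILT(𝓤)` of S4 addendum 30 (1) is the statement `B_c(m, m|_𝓤) ≥ 0` — the bilinear form of
`crossC` between the law of `K = C(a₂)` on `Q` and its restriction to the up-set `𝓤` of clusters.
This file settles the up-sets generated by the marks `o`, `b`:

* **`uptilt_both_marks_nonneg`**: `𝓤 = {K ∋ o, b}` — a THEOREM for every weight vector and every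
  admissible `c`: `B_c(m, m|_{o,b ∈ K}) = Dv·(2Z − x − y) + 2t·Dv + t·(c·x − xv) + t·(c·y − yv) ≥ 0`
  (`uptilt_both_marks_eq`; the two bounds are `prob_Q_vL_le_mul`);
* **`uptilt_mark_eq`**: `𝓤 = {K ∋ o}` — `B_c(m, m|_{o ∈ K}) = crossC + x·Dv + t·(c·x − xv)`, so the
  tilt at a single mark is `≥ crossC` (`uptilt_mark_ge_crossC`): a theorem modulo the crux itself
  (and the same at `b` by symmetry);
* `biForm_self`: `B_c(m, m) = 2·crossC`.

Here `t = P(Q, oH, bH)` and `m|_𝓤` denotes the six masses restricted to `{K ∈ 𝓤}`.  Own work;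
standard axioms.
-/

namespace Summit.Ventures.PercRepro2

open LeafRowPendantRootSO CrossAPrimeSupport CrossAPrimeA2Route CrossAPrimeA2Induction
  CrossAPrimeCoinSplit

namespace CrossAPrimeUptiltMarks

section Algebra

variable {V : Type*} {E : Type*} [Fintype E] [DecidableEq E] {R : Type*} [Field R]
variable {ends : E → Sym2 V}

/-- `B_c(m, m) = 2·crossC`. -/
lemma biForm_self (p : E → R) (c : R) (o a₁ a₂ v b : V) :
    biForm (prob p (avoidAll ends a₂ {a₁}))
        (prob p (avoidAll ends a₂ {a₁} ∩ connEvent ends a₂ o))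
        (prob p (avoidAll ends a₂ {a₁} ∩ connEvent ends a₂ b))
        (prob p (avoidAll ends a₂ {a₁} ∩ (connEvent ends a₁ v ∩ connEvent ends a₂ o)))
        (prob p (avoidAll ends a₂ {a₁} ∩ (connEvent ends a₁ v ∩ connEvent ends a₂ b)))
        (prob p (avoidAll ends a₂ {a₁} ∩
          (connEvent ends a₁ v ∩ (connEvent ends a₂ o ∩ connEvent ends a₂ b))))
        (prob p (avoidAll ends a₂ {a₁}))
        (prob p (avoidAll ends a₂ {a₁} ∩ connEvent ends a₂ o))
        (prob p (avoidAll ends a₂ {a₁} ∩ connEvent ends a₂ b))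
        (prob p (avoidAll ends a₂ {a₁} ∩ (connEvent ends a₁ v ∩ connEvent ends a₂ o)))
        (prob p (avoidAll ends a₂ {a₁} ∩ (connEvent ends a₁ v ∩ connEvent ends a₂ b)))
        (prob p (avoidAll ends a₂ {a₁} ∩
          (connEvent ends a₁ v ∩ (connEvent ends a₂ o ∩ connEvent ends a₂ b)))) c =
      2 * crossC p c ends o a₁ a₂ v b := by
  unfold biForm crossC
  ring

/-- **The tilt at `{K ∋ o, b}`, as an identity**: the restricted masses are
`(t, t, t, Dv, Dv, Dv)` with `t = P(Q, oH, bH)`, and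
`B_c(m, m|_{o,b ∈ K}) = Dv·(2Z − x − y) + 2t·Dv + t·(c·x − xv) + t·(c·y − yv)`. -/
lemma uptilt_both_marks_eq (p : E → R) (c : R) (o a₁ a₂ v b : V) :
    biForm (prob p (avoidAll ends a₂ {a₁}))
        (prob p (avoidAll ends a₂ {a₁} ∩ connEvent ends a₂ o))
        (prob p (avoidAll ends a₂ {a₁} ∩ connEvent ends a₂ b))
        (prob p (avoidAll ends a₂ {a₁} ∩ (connEvent ends a₁ v ∩ connEvent ends a₂ o)))
        (prob p (avoidAll ends a₂ {a₁} ∩ (connEvent ends a₁ v ∩ connEvent ends a₂ b)))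
        (prob p (avoidAll ends a₂ {a₁} ∩
          (connEvent ends a₁ v ∩ (connEvent ends a₂ o ∩ connEvent ends a₂ b))))
        (prob p (avoidAll ends a₂ {a₁} ∩ (connEvent ends a₂ o ∩ connEvent ends a₂ b)))
        (prob p (avoidAll ends a₂ {a₁} ∩ (connEvent ends a₂ o ∩ connEvent ends a₂ b)))
        (prob p (avoidAll ends a₂ {a₁} ∩ (connEvent ends a₂ o ∩ connEvent ends a₂ b)))
        (prob p (avoidAll ends a₂ {a₁} ∩
          (connEvent ends a₁ v ∩ (connEvent ends a₂ o ∩ connEvent ends a₂ b))))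
        (prob p (avoidAll ends a₂ {a₁} ∩
          (connEvent ends a₁ v ∩ (connEvent ends a₂ o ∩ connEvent ends a₂ b))))
        (prob p (avoidAll ends a₂ {a₁} ∩
          (connEvent ends a₁ v ∩ (connEvent ends a₂ o ∩ connEvent ends a₂ b)))) c =
      prob p (avoidAll ends a₂ {a₁} ∩
          (connEvent ends a₁ v ∩ (connEvent ends a₂ o ∩ connEvent ends a₂ b))) *
          (2 * prob p (avoidAll ends a₂ {a₁}) -
            prob p (avoidAll ends a₂ {a₁} ∩ connEvent ends a₂ o) -
            prob p (avoidAll ends a₂ {a₁} ∩ connEvent ends a₂ b)) +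
        2 * prob p (avoidAll ends a₂ {a₁} ∩ (connEvent ends a₂ o ∩ connEvent ends a₂ b)) *
          prob p (avoidAll ends a₂ {a₁} ∩
            (connEvent ends a₁ v ∩ (connEvent ends a₂ o ∩ connEvent ends a₂ b))) +
        prob p (avoidAll ends a₂ {a₁} ∩ (connEvent ends a₂ o ∩ connEvent ends a₂ b)) *
          (c * prob p (avoidAll ends a₂ {a₁} ∩ connEvent ends a₂ o) -
            prob p (avoidAll ends a₂ {a₁} ∩ (connEvent ends a₁ v ∩ connEvent ends a₂ o))) +
        prob p (avoidAll ends a₂ {a₁} ∩ (connEvent ends a₂ o ∩ connEvent ends a₂ b)) *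
          (c * prob p (avoidAll ends a₂ {a₁} ∩ connEvent ends a₂ b) -
            prob p (avoidAll ends a₂ {a₁} ∩ (connEvent ends a₁ v ∩ connEvent ends a₂ b))) := by
  unfold biForm
  ring

/-- **The tilt at `{K ∋ o}`, as an identity**: the restricted masses are `(x, x, t, xv, Dv, Dv)` and
`B_c(m, m|_{o ∈ K}) = crossC + x·Dv + t·(c·x − xv)`. -/
lemma uptilt_mark_eq (p : E → R) (c : R) (o a₁ a₂ v b : V) :
    biForm (prob p (avoidAll ends a₂ {a₁}))
        (prob p (avoidAll ends a₂ {a₁} ∩ connEvent ends a₂ o))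
        (prob p (avoidAll ends a₂ {a₁} ∩ connEvent ends a₂ b))
        (prob p (avoidAll ends a₂ {a₁} ∩ (connEvent ends a₁ v ∩ connEvent ends a₂ o)))
        (prob p (avoidAll ends a₂ {a₁} ∩ (connEvent ends a₁ v ∩ connEvent ends a₂ b)))
        (prob p (avoidAll ends a₂ {a₁} ∩
          (connEvent ends a₁ v ∩ (connEvent ends a₂ o ∩ connEvent ends a₂ b))))
        (prob p (avoidAll ends a₂ {a₁} ∩ connEvent ends a₂ o))
        (prob p (avoidAll ends a₂ {a₁} ∩ connEvent ends a₂ o))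
        (prob p (avoidAll ends a₂ {a₁} ∩ (connEvent ends a₂ o ∩ connEvent ends a₂ b)))
        (prob p (avoidAll ends a₂ {a₁} ∩ (connEvent ends a₁ v ∩ connEvent ends a₂ o)))
        (prob p (avoidAll ends a₂ {a₁} ∩
          (connEvent ends a₁ v ∩ (connEvent ends a₂ o ∩ connEvent ends a₂ b))))
        (prob p (avoidAll ends a₂ {a₁} ∩
          (connEvent ends a₁ v ∩ (connEvent ends a₂ o ∩ connEvent ends a₂ b)))) c =
      crossC p c ends o a₁ a₂ v b +
        prob p (avoidAll ends a₂ {a₁} ∩ connEvent ends a₂ o) *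
          prob p (avoidAll ends a₂ {a₁} ∩
            (connEvent ends a₁ v ∩ (connEvent ends a₂ o ∩ connEvent ends a₂ b))) +
        prob p (avoidAll ends a₂ {a₁} ∩ (connEvent ends a₂ o ∩ connEvent ends a₂ b)) *
          (c * prob p (avoidAll ends a₂ {a₁} ∩ connEvent ends a₂ o) -
            prob p (avoidAll ends a₂ {a₁} ∩ (connEvent ends a₁ v ∩ connEvent ends a₂ o))) := by
  unfold biForm crossC
  ring

end Algebra

section Signs

variable {V : Type*} {E : Type*} [Fintype E] [DecidableEq E] [Fintype V] [DecidableEq V]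
  {R : Type*} [Field R] [LinearOrder R] [IsStrictOrderedRing R]
variable {ends : E → Sym2 V}

omit [DecidableEq V] in
/-- `xv ≤ c·x` under an admissible `c` (the bound `G_S ≤ c·m_S` at the family `{K ∋ o}`). -/
lemma vL_mark_le_mul {p : E → R} (hp : IsProbVec p) {c : R} {a₁ a₂ v : V}
    (hadm : Adm p c ends a₁ a₂ v) (o : V) :
    prob p (avoidAll ends a₂ {a₁} ∩ (connEvent ends a₁ v ∩ connEvent ends a₂ o)) ≤
      c * prob p (avoidAll ends a₂ {a₁} ∩ connEvent ends a₂ o) := by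
  have h := CrossAPrimeA2VEdge.prob_Q_vL_le_mul hp hadm {A : Set V | o ∈ A}
  have e1 : clusterInEvent ends a₂ {A : Set V | o ∈ A} ∩ connEvent ends a₁ v ∩
      avoidAll ends a₂ {a₁} =
      avoidAll ends a₂ {a₁} ∩ (connEvent ends a₁ v ∩ connEvent ends a₂ o) := by
    ext ω
    simp only [Set.mem_inter_iff, clusterInEvent, Set.mem_setOf_eq, mem_cluster, connEvent]
    tauto
  have e2 : clusterInEvent ends a₂ {A : Set V | o ∈ A} ∩ avoidAll ends a₂ {a₁} =
      avoidAll ends a₂ {a₁} ∩ connEvent ends a₂ o := by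
    ext ω
    simp only [Set.mem_inter_iff, clusterInEvent, Set.mem_setOf_eq, mem_cluster, connEvent]
    tauto
  rw [e1, e2] at h
  exact h

omit [DecidableEq V] in
/-- **`UPTILT({K ∋ o, b})` is a theorem**: for every weight vector and admissible `c`,
`0 ≤ B_c(m, m|_{o,b ∈ K})`. -/
theorem uptilt_both_marks_nonneg {p : E → R} (hp : IsProbVec p) {c : R} {a₁ a₂ v : V}
    (hadm : Adm p c ends a₁ a₂ v) (o b : V) :
    0 ≤ biForm (prob p (avoidAll ends a₂ {a₁}))
        (prob p (avoidAll ends a₂ {a₁} ∩ connEvent ends a₂ o))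
        (prob p (avoidAll ends a₂ {a₁} ∩ connEvent ends a₂ b))
        (prob p (avoidAll ends a₂ {a₁} ∩ (connEvent ends a₁ v ∩ connEvent ends a₂ o)))
        (prob p (avoidAll ends a₂ {a₁} ∩ (connEvent ends a₁ v ∩ connEvent ends a₂ b)))
        (prob p (avoidAll ends a₂ {a₁} ∩
          (connEvent ends a₁ v ∩ (connEvent ends a₂ o ∩ connEvent ends a₂ b))))
        (prob p (avoidAll ends a₂ {a₁} ∩ (connEvent ends a₂ o ∩ connEvent ends a₂ b)))
        (prob p (avoidAll ends a₂ {a₁} ∩ (connEvent ends a₂ o ∩ connEvent ends a₂ b)))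
        (prob p (avoidAll ends a₂ {a₁} ∩ (connEvent ends a₂ o ∩ connEvent ends a₂ b)))
        (prob p (avoidAll ends a₂ {a₁} ∩
          (connEvent ends a₁ v ∩ (connEvent ends a₂ o ∩ connEvent ends a₂ b))))
        (prob p (avoidAll ends a₂ {a₁} ∩
          (connEvent ends a₁ v ∩ (connEvent ends a₂ o ∩ connEvent ends a₂ b))))
        (prob p (avoidAll ends a₂ {a₁} ∩
          (connEvent ends a₁ v ∩ (connEvent ends a₂ o ∩ connEvent ends a₂ b)))) c := by
  rw [uptilt_both_marks_eq]
  have hx := vL_mark_le_mul hp hadm o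
  have hy := vL_mark_le_mul hp hadm b
  have hxZ := prob_inter_le_left hp (avoidAll ends a₂ {a₁}) (connEvent ends a₂ o)
  have hyZ := prob_inter_le_left hp (avoidAll ends a₂ {a₁}) (connEvent ends a₂ b)
  have hD := prob_nonneg hp (avoidAll ends a₂ {a₁} ∩
    (connEvent ends a₁ v ∩ (connEvent ends a₂ o ∩ connEvent ends a₂ b)))
  have ht := prob_nonneg hp (avoidAll ends a₂ {a₁} ∩ (connEvent ends a₂ o ∩ connEvent ends a₂ b))
  have k1 := mul_nonneg hD (by linarith : (0 : R) ≤ 2 * prob p (avoidAll ends a₂ {a₁}) -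
    prob p (avoidAll ends a₂ {a₁} ∩ connEvent ends a₂ o) -
    prob p (avoidAll ends a₂ {a₁} ∩ connEvent ends a₂ b))
  have k2 := mul_nonneg ht hD
  have k3 := mul_nonneg ht (sub_nonneg.2 hx)
  have k4 := mul_nonneg ht (sub_nonneg.2 hy)
  linarith [k1, k2, k3, k4]

omit [DecidableEq V] in
/-- **The tilt at a single mark dominates the crux**: `crossC ≤ B_c(m, m|_{o ∈ K})` for every
weight vector and admissible `c` (so `UPTILT({K ∋ o})` follows from the crux of the same measure). -/
theorem uptilt_mark_ge_crossC {p : E → R} (hp : IsProbVec p) {c : R} {a₁ a₂ v : V}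
    (hadm : Adm p c ends a₁ a₂ v) (o b : V) :
    crossC p c ends o a₁ a₂ v b ≤
      biForm (prob p (avoidAll ends a₂ {a₁}))
        (prob p (avoidAll ends a₂ {a₁} ∩ connEvent ends a₂ o))
        (prob p (avoidAll ends a₂ {a₁} ∩ connEvent ends a₂ b))
        (prob p (avoidAll ends a₂ {a₁} ∩ (connEvent ends a₁ v ∩ connEvent ends a₂ o)))
        (prob p (avoidAll ends a₂ {a₁} ∩ (connEvent ends a₁ v ∩ connEvent ends a₂ b)))
        (prob p (avoidAll ends a₂ {a₁} ∩
          (connEvent ends a₁ v ∩ (connEvent ends a₂ o ∩ connEvent ends a₂ b))))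
        (prob p (avoidAll ends a₂ {a₁} ∩ connEvent ends a₂ o))
        (prob p (avoidAll ends a₂ {a₁} ∩ connEvent ends a₂ o))
        (prob p (avoidAll ends a₂ {a₁} ∩ (connEvent ends a₂ o ∩ connEvent ends a₂ b)))
        (prob p (avoidAll ends a₂ {a₁} ∩ (connEvent ends a₁ v ∩ connEvent ends a₂ o)))
        (prob p (avoidAll ends a₂ {a₁} ∩
          (connEvent ends a₁ v ∩ (connEvent ends a₂ o ∩ connEvent ends a₂ b))))
        (prob p (avoidAll ends a₂ {a₁} ∩
          (connEvent ends a₁ v ∩ (connEvent ends a₂ o ∩ connEvent ends a₂ b)))) c := by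
  rw [uptilt_mark_eq]
  have hx := vL_mark_le_mul hp hadm o
  have hx0 := prob_nonneg hp (avoidAll ends a₂ {a₁} ∩ connEvent ends a₂ o)
  have hD := prob_nonneg hp (avoidAll ends a₂ {a₁} ∩
    (connEvent ends a₁ v ∩ (connEvent ends a₂ o ∩ connEvent ends a₂ b)))
  have ht := prob_nonneg hp (avoidAll ends a₂ {a₁} ∩ (connEvent ends a₂ o ∩ connEvent ends a₂ b))
  have k1 := mul_nonneg hx0 hD
  have k2 := mul_nonneg ht (sub_nonneg.2 hx)
  linarith [k1, k2]

end Signs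

end CrossAPrimeUptiltMarks

end Summit.Ventures.PercRepro2
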